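/-
Copyright (c) 2026. All rights reserved.
Released under Apache 2.0 license as described in the file LICENSE.
Authors: abc-iut cell, seat abc-iut-L6-t6 (the last sentence of [IUTchIII] Example 3.6 (iii), part 6: the
`𝓕⊛_MOD` side on THE perfection; proof-only).
-/
import Literature.IUT.LogThetaLattice.GlobalFrobenioidModelsIndeterminacy
import Literature.AlgebraicGeometry.Frobenioids.PerfectionFunctorialityComp
import HarnessLib

/-!
# [IUTchIII] Example 3.6 (iii), last sentence — the twisted identifications `𝓕⊛_𝔪𝔬𝔡 ⥲ 𝓕⊛_MOD` all induce
# `toMOD^pf` on THE perfections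

S. Mochizuki, *Inter-universal Teichmüller Theory III*, kurims manuscript (May 2020), Example 3.6 (iii),
p. 108 [claim key Mochizuki2012, status disputed (D-0012)]: "… the induced isomorphism between the respective
perfections … of `𝓕⊛_𝔪𝔬𝔡`, `𝓕⊛_MOD` is completely determined by this condition."

Part 1 (`GlobalFrobenioidModelsUnitTwist.lean`) packages the indeterminacy on the `𝓕⊛_MOD` side as the
identifications `Ψ_u ⋙ toMOD : 𝓕⊛_𝔪𝔬𝔡 ⥤ 𝓕⊛_MOD` (`ex36iii_not_determined`: `≠ toMOD` for `u ≠ 1`, equal to `toMOD`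
on objects and linear morphisms, Frobenius-compatible — `isFrobeniusCompatible_twistedToMOD`).  This proof-only
file draws the perfection-level consequence announced there, from this seat's `perfection_map_unitTwist`
(part 5) and the ON-THE-NOSE functoriality of `(−)^pf` (`Perfection.map_comp_eq`, `Perfection.map_id_eq`,
`PerfectionFunctorialityComp.lean`, [FrdI] Thm. 3.4 (iii)):
* `FrakCat.perfection_map_unitTwist_eq_id` — `(Ψ_u)^pf = 𝟭_{(𝓕⊛_𝔪𝔬𝔡)^pf}` for `u` of finite order;
* **`perfection_map_twistedToMOD`** — `(Ψ_u ⋙ toMOD)^pf = toMOD^pf` for `u` of finite order, for ANY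
  Frobenius-compatibility witness (abstract datum);
* `perfection_map_comp_toMOD_of_admissible` — the same for every admissible `Ψ` (part 4's classification) in
  place of `Ψ_u`, torsion of the twisting unit assumed;
* `Prop37.perfection_map_comp_toMOD` — at the number-field model `(†𝓕⊛_𝔪𝔬𝔡)_α = Prop37.Ffrak F` with NO torsion
  hypothesis (Kronecker): every admissible auto-equivalence `Ψ` gives `(Ψ ⋙ toMOD)^pf = toMOD^pf`.
READING as in parts 1–5 (functors on the nose).  Theorems only; no new definitions.  HONEST FRAMING: elementary
category theory of the tree's own model of Ex. 3.6; nothing here bears on [IUTchIII] Cor. 3.12; typed ≠ endorsed.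
-/

namespace Literature.IUT.LogThetaLattice

open CategoryTheory Literature.AlgebraicGeometry.Frobenioids PreFrobenioid

namespace GlobalFrobenioidModels

universe u

variable {F : Type u} [Field F] {V : Type u} {Γ : V → Type u} [∀ v, AddCommGroup (Γ v)]
  {nonneg : ∀ v, AddSubmonoid (Γ v)} {β : ∀ v, Additive Fˣ →+ Γ v}
  {H : ModelHyps nonneg β} {hF : PreFrobenioid.IsFrobenioid (structureFunctor H)}
  {hM : PreFrobenioid.IsFrobenioid (structureFunctorMOD H)}

/-- **`(Ψ_u)^pf = 𝟭`** for `u` of finite order (part 5's `perfection_map_unitTwist` with `(𝟭)^pf = 𝟭`,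
`Perfection.map_id_eq`). ([IUTchIII] Ex 3.6 (iii) p.108) [claim: Mochizuki2012, status: disputed] -/
theorem FrakCat.perfection_map_unitTwist_eq_id (u : Fˣ) (hu : ∀ v, β v (Additive.ofMul u) = 0)
    (hfin : IsOfFinOrder u) :
    PreFrobenioid.Perfection.map (hF₁ := hF) (hF₂ := hF) (FrakCat.isFrobeniusCompatible_unitTwist u hu H) =
      𝟭 (Perfection hF) := by
  rw [FrakCat.perfection_map_unitTwist u hu hfin, Perfection.map_id_eq]

/-- **`(Ψ_u ⋙ toMOD)^pf = toMOD^pf` for `u` of finite order** (abstract datum, any compatibility witness): the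
twisted identification `𝓕⊛_𝔪𝔬𝔡 ⥲ 𝓕⊛_MOD` of part 1 induces on THE perfections the same functor as `toMOD`.
([IUTchIII] Ex 3.6 (iii) p.108) [claim: Mochizuki2012, status: disputed] -/
theorem perfection_map_twistedToMOD (u : Fˣ) (hu : ∀ v, β v (Additive.ofMul u) = 0) (hfin : IsOfFinOrder u)
    (hΨ : IsFrobeniusCompatible (structureFunctor H) (structureFunctorMOD H)
      (FrakCat.unitTwist u hu ⋙ (toMOD : FrakCat F V Γ nonneg β ⥤ MODCat F V Γ nonneg β))) :
    PreFrobenioid.Perfection.map (hF₁ := hF) (hF₂ := hM) hΨ =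
      PreFrobenioid.Perfection.map (hF₁ := hF) (hF₂ := hM) (isFrobeniusCompatible_toMOD H) := by
  rw [Perfection.map_comp_eq (hF₂ := hF) (FrakCat.isFrobeniusCompatible_unitTwist u hu H)
    (isFrobeniusCompatible_toMOD H) hΨ, FrakCat.perfection_map_unitTwist_eq_id u hu hfin, Functor.id_comp]

/-- **Every admissible `Ψ` followed by `toMOD` induces `toMOD^pf`** (abstract datum): for a full functor
`Ψ : 𝓕⊛_𝔪𝔬𝔡 ⥤ 𝓕⊛_𝔪𝔬𝔡` fixing objects, Frobenius degrees and the rational function of every linear morphism, whose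
twisting unit `(fn Ψ(2,1))⁻¹` is torsion (automatic at the number-field model), and any compatibility witness
for `Ψ ⋙ toMOD`, `(Ψ ⋙ toMOD)^pf = toMOD^pf`. ([IUTchIII] Ex 3.6 (iii) p.108) [claim: Mochizuki2012, status: disputed] -/
theorem perfection_map_comp_toMOD_of_admissible (Ψ : FrakCat F V Γ nonneg β ⥤ FrakCat F V Γ nonneg β)
    (hobj : ∀ X, Ψ.obj X = X)
    (hdeg : ∀ ⦃X Y : FrakCat F V Γ nonneg β⦄ (φ : X ⟶ Y), FrakCat.deg (Ψ.map φ) = FrakCat.deg φ)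
    (hlin : ∀ ⦃X Y : FrakCat F V Γ nonneg β⦄ (φ : X ⟶ Y), FrakCat.deg φ = 1 →
      FrakCat.fn (Ψ.map φ) = FrakCat.fn φ)
    (hfull : ∀ ⦃X Y : FrakCat F V Γ nonneg β⦄ (τ : Ψ.obj X ⟶ Ψ.obj Y), ∃ φ : X ⟶ Y, Ψ.map φ = τ)
    (hfin : IsOfFinOrder (FrakCat.fn (Ψ.map (FrakCat.frobTwo (nonneg := nonneg) (β := β)))))
    (hΨ : IsFrobeniusCompatible (structureFunctor H) (structureFunctorMOD H)
      (Ψ ⋙ (toMOD : FrakCat F V Γ nonneg β ⥤ MODCat F V Γ nonneg β))) :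
    PreFrobenioid.Perfection.map (hF₁ := hF) (hF₂ := hM) hΨ =
      PreFrobenioid.Perfection.map (hF₁ := hF) (hF₂ := hM) (isFrobeniusCompatible_toMOD H) := by
  obtain ⟨u, hu, huΨ⟩ := FrakCat.eq_unitTwist_of_full Ψ hdeg hlin H hobj hfull
  have hfin' : IsOfFinOrder u := by
    have h : FrakCat.fn (Ψ.map (FrakCat.frobTwo (nonneg := nonneg) (β := β))) = u⁻¹ := by
      rw [huΨ]; exact FrakCat.fn_unitTwist_map_frobTwo u hu
    rw [h] at hfin
    exact isOfFinOrder_inv_iff.mp hfin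
  subst huΨ
  exact perfection_map_twistedToMOD u hu hfin' hΨ

end GlobalFrobenioidModels

/-! ### The number-field model -/

namespace Prop37

open GlobalFrobenioidModels
open Literature.AlgebraicGeometry.Frobenioids (Places)

variable (F : Type) [Field F] [NumberField F]

/-- **[IUTchIII] Ex. 3.6 (iii), last sentence, `𝓕⊛_MOD` side, at the number-field model**: for every admissible
auto-equivalence `Ψ` of `(†𝓕⊛_𝔪𝔬𝔡)_α` (identity on objects, Frobenius degrees preserved, identity on `F^×_mod`),
the isomorphism of Frobenioids `Ψ ⋙ toMOD : (†𝓕⊛_𝔪𝔬𝔡)_α ⥲ (†𝓕⊛_MOD)_α` — which agrees with `toMOD` on objects and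
linear morphisms and may differ from it (part 1) — induces on THE perfections the SAME functor as `toMOD`,
for any compatibility witness; NO torsion hypothesis (the twisting unit is a root of unity, Kronecker).
([IUTchIII] Ex 3.6 (iii) p.108) [claim: Mochizuki2012, status: disputed] -/
theorem perfection_map_comp_toMOD (Ψ : Ffrak F ⥤ Ffrak F) [Ψ.IsEquivalence] (hobj : ∀ X, Ψ.obj X = X)
    (hdeg : ∀ ⦃X Y : Ffrak F⦄ (φ : X ⟶ Y), FrakCat.deg (Ψ.map φ) = FrakCat.deg φ)
    (hlin : ∀ ⦃X Y : Ffrak F⦄ (φ : X ⟶ Y), FrakCat.deg φ = 1 → FrakCat.fn (Ψ.map φ) = FrakCat.fn φ)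
    (hΨ : IsFrobeniusCompatible (structureFunctor (modelHyps F)) (structureFunctorMOD (modelHyps F))
      (Ψ ⋙ (toMOD : Ffrak F ⥤ MODCat F (Places F) (Gamma F) (nonneg F) (beta F)))) :
    PreFrobenioid.Perfection.map (hF₁ := isFrobenioid (modelHyps F)) (hF₂ := isFrobenioid_MOD (modelHyps F)) hΨ =
      PreFrobenioid.Perfection.map (hF₁ := isFrobenioid (modelHyps F)) (hF₂ := isFrobenioid_MOD (modelHyps F))
        (isFrobeniusCompatible_toMOD (modelHyps F)) := by
  obtain ⟨⟨u, hu, hfin, huΨ⟩, -, -⟩ := ex36iii_determined F Ψ hobj hdeg hlin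
  subst huΨ
  exact perfection_map_twistedToMOD u hu hfin hΨ

end Prop37

end Literature.IUT.LogThetaLattice
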